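import Mathlib
import Literature.AlgebraicGeometry.Tropical.TorusCycles
import Summits.HodgeConjecture.HodgeConjecture.Theorems.TropicalWeilObstructionTropicalWeilVanishingPrymThree
import HarnessLib

/-!
# Route `TropicalWeilObstruction` (Kontsevich's tropical test — NEGATION SINK, exploration, no summit claim):
# the `n = 3` CALIBRATION FAMILY, part III — the universal forms of the `n = 3` calibration, typed

Negation-sink bookkeeping of the cell `pub-hodge-tropical` (seat tropical-1 gen 25, on the referee remark R-P2-2 of seat tropical-2 gen 20).
Part II (`…TropicalWeilVanishingPrymThree`) typed the EXISTENTIAL calibration statement `TropicalSchoenCalibrationThree` (one Weil-generic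
tropical Schoen–Prym period of the metric `K_{3,3}` carrying an effective tropical `3`-cycle with `W ≠ 0`) — the right CALIBRATION WITNESS: it
already refutes the verbatim `n = 3` analogue of the crux K1. What the classical picture (Schoen 1988, Koike 2002 Cor. 2.1: the Weil classes of EVERY
abelian sixfold of Weil type with `K = ℚ(i)`, `δ = 1` are algebraic; Markman 2025 for all Weil type) together with the transfer thesis T of the cell
predicts is the UNIVERSAL form. This file names the two universal variants and records the trivial implications, so that the three `n = 3`
statements and the `n = 3` analogue of K1 sit in one implication chain in the kernel:

`TropicalWeilNonVanishingThree` (every Weil-generic period) ⟹ `TropicalSchoenCalibrationThreeUniversal` (every Weil-generic PRYM period)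
⟹ `TropicalSchoenCalibrationThree` (some Weil-generic Prym period) ⟹ ¬(`n = 3` analogue of `TropicalWeilVanishing`).

HONEST STATUS. All three are OPEN; nothing is claimed; calibration statements one dimension below the crux, deciding nothing about K1 (`n = 4`),
K1_∂, K2 or the Hodge conjecture. Two `@[conjecture]` definitions, two one-line implications, no named-fact hypothesis, no sorry.
References: [Zharkov2020TropicalWeil] I. Zharkov, arXiv:2002.02347, §2 (pp. 2–4); K. Koike, arXiv:math/0211304, Cor. 2.1; C. Schoen, Compositio
Math. 65 (1988); E. Markman, arXiv:2502.03415.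
-/

set_option linter.dupNamespace false

noncomputable section

namespace Summit.HodgeConjecture.HodgeConjecture.Theorems.TropicalWeilVanishing

namespace PrymThree

open scoped BigOperators Matrix
open Matrix Literature.AlgebraicGeometry.Tropical

/-- **K2-cal at `n = 3`, UNIVERSAL PRYM FORM (OPEN; expected TRUE).** At EVERY tropical Schoen–Prym period of the metric `K_{3,3}` with positive,
algebraically independent edge lengths (hence Weil-generic, positive definite and `J`-commuting: `exists_weilGeneric_prymPeriod`,
`isWeilGeneric_prymPeriod_iff`) there is an effective tropical `3`-cycle with Weil functional `≠ 0`. The expected witness is one and the same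
combinatorial object at all such periods — the tropicalised Schoen cycle `AP_*(N⁻¹|K_{Γ'}|)` built from the realizable canonical locus of `K_{3,3}`
(not built; HOME `certificates/canonK33/`, `certificates/prymtorelli/` §6). Implies the existential form `TropicalSchoenCalibrationThree` of part II
(`tropicalSchoenCalibrationThree_of_universal`). HONEST STATUS: open; nothing here bears on the Hodge conjecture.
[cite: Zharkov2020TropicalWeil, §2 (pp. 2–4)] -/
@[conjecture] def TropicalSchoenCalibrationThreeUniversal : Prop :=
  ∀ ℓ : Fin 9 → ℝ, (∀ e, 0 < ℓ e) → AlgebraicIndependent ℚ ℓ →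
    ∃ Z : TropicalTorusCycle (2 * 3) 3 (prymPeriod ℓ), weilFunctional Z ≠ 0

/-- **The `n = 3` MIRROR STATEMENT (OPEN; predicted by the classical algebraicity of Weil classes on `ℚ(i)`-Weil sixfolds together with the cell's
transfer thesis T).** At EVERY positive definite real `6 × 6` period `Q` commuting with `weilJ 3` whose nine free entries are algebraically independent
over `ℚ` there is an effective tropical `3`-cycle on `ℝ⁶/Qℤ⁶` with `W ≠ 0` — the exact negation-pattern of the crux K1 one dimension down, quantified
universally (K1 says: at `n = 4`, never). Beyond the Prym cone this needs more than the Schoen cycle (R-PT-1: whether the Prym cones of all graphs and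
cover classes exhaust the Weil-generic periods up to `GL₃(ℤ[i])` is a tropical Weil–Schottky question, not addressed). Implies the universal Prym form
(`tropicalSchoenCalibrationThreeUniversal_of_nonVanishing`). HONEST STATUS: open; nothing here bears on the Hodge conjecture.
[cite: Zharkov2020TropicalWeil, §2 (pp. 2–4)] -/
@[conjecture] def TropicalWeilNonVanishingThree : Prop :=
  ∀ Q : Matrix (Fin (2 * 3)) (Fin (2 * 3)) ℝ, Q.PosDef → Q * weilJ 3 = weilJ 3 * Q → IsWeilGeneric 3 Q →
    ∃ Z : TropicalTorusCycle (2 * 3) 3 Q, weilFunctional Z ≠ 0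

/-- The mirror statement at every Weil-generic period implies the universal Prym form (Prym periods with positive algebraically independent
edge lengths satisfy the three hypotheses: part I/II). [cite: Zharkov2020TropicalWeil, §2 (pp. 2–4)] -/
theorem tropicalSchoenCalibrationThreeUniversal_of_nonVanishing (h : TropicalWeilNonVanishingThree) :
    TropicalSchoenCalibrationThreeUniversal := fun ℓ hpos hai =>
  h (prymPeriod ℓ) (prymPeriod_posDef hpos) (prymPeriod_mul_weilJ ℓ) ((isWeilGeneric_prymPeriod_iff ℓ).2 hai)

/-- The universal Prym form implies the existential calibration statement of part II (positive algebraically independent edge lengths exist,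
`exists_pos_algebraicIndependent`). [cite: Zharkov2020TropicalWeil, §2 (pp. 2–4)] -/
theorem tropicalSchoenCalibrationThree_of_universal (h : TropicalSchoenCalibrationThreeUniversal) :
    TropicalSchoenCalibrationThree := by
  obtain ⟨ℓ, hpos, hai⟩ := exists_pos_algebraicIndependent
  exact ⟨ℓ, hpos, hai, h ℓ hpos hai⟩

/-- The chain closes on the crux pattern: the mirror statement refutes the verbatim `n = 3` analogue of K1 (through parts II–III).
[cite: Zharkov2020TropicalWeil, §2 (pp. 2–4)] -/
theorem not_tropicalWeilVanishing_three_of_nonVanishing (h : TropicalWeilNonVanishingThree) :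
    ¬ (∀ Q : Matrix (Fin (2 * 3)) (Fin (2 * 3)) ℝ, Q.PosDef → Q * weilJ 3 = weilJ 3 * Q → IsWeilGeneric 3 Q →
        ∀ Z : TropicalTorusCycle (2 * 3) 3 Q, weilFunctional Z = 0) :=
  not_tropicalWeilVanishing_three_of_schoenCalibration
    (tropicalSchoenCalibrationThree_of_universal (tropicalSchoenCalibrationThreeUniversal_of_nonVanishing h))

end PrymThree

end Summit.HodgeConjecture.HodgeConjecture.Theorems.TropicalWeilVanishing

end
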